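import Summits.HodgeConjecture.HodgeConjecture.Theorems.K2LiuDoublingHeightDecayOfNormIntegrable   -- ★ p855258 (K2Liu-p04): `doublingSectionIntegrable_of_adelicNormIntegrable` (#16b ⇒ this socket)
import Summits.HodgeConjecture.HodgeConjecture.Theorems.K2LiuAdelicNormIntegrable                -- ★ p855222 (K2Liu-p03): #16b `adelicNormIntegrable` BY NAME
import HarnessLib

/-!
# Crux `HLiu418`, Track B road `K2_Liu`, unit U5 «DOUBLING ZETA» — socket #14a `sig_K2LiuDoublingSectionIntegrable` PAID BY NAME (row #14 (a) «the Siegel section is L¹ along ι(·,1)»)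

Cell `hodgecm-mathlib`, crux item hLiu418 = `stmt-HodgeConjecture-24832`, route of record `HCCMUnconditional`; squad K2 ∕ K2Liu, prover K2Liu-p04 (g0).
Socket #14a `sig_K2LiuDoublingSectionIntegrable` of `Cruxes/HLiu418/Lines/K2_Liu_CurveThetaSigs_U5_DoublingZeta.lean`, U5 ED. 6 (5cff0c75aa6afdae) :59–:70 — statement below
BYTE-IDENTICAL (block sha16 3d6d85263d1ebad6); THEOREMS ONLY; lane `--supports stmt-HodgeConjecture-24832 --as helper`.

THE ARGUMENT ([Liu2021, Lem. B.10 (2) p. 102: «absolutely convergent for Re(s) > (n+a)∕2», proof «as in [Mœg97, §2.1]»]; [GelbartPiatetskishapiroRallis1987,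
Part A §1]).  Iwasawa `H(𝔸) = P_Δ(𝔸)·K` (★ (I) `exists_isCompact_isSiegelDelta_mul`) bounds a continuous section by
`‖f|_K‖_∞ · |χ(det_Δ p)| · |det_Δ p|^{Re s + n∕2}`, i.e. by a power of the continuous height of record (★ `exists_siegelHeight_continuous`), whose
powers `≥ τ₁` are integrable along `ι(·,1)` (★ #16 = ★ #16a + ★ #16b); ★ p854858∕p854882 turn this into `σ₀` (general `χ`: `|χ| = ‖·‖^σ`).  All of
it is packaged in ★ p855258 `doublingSectionIntegrable_of_adelicNormIntegrable : ‹#16b› → ‹#14a›`, of which this file is the one-line application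
to ★ #16b `K2LiuAdelicNormIntegrable.adelicNormIntegrable`.

HONEST LABEL.  `HC_CM` is proved only modulo the 7 printed citations (2 remaining named inputs: hLiu418 = `stmt-HodgeConjecture-24832`, h413 =
`stmt-HodgeConjecture-24833`) until rung 0 closes; this file pays ONE tier-1 socket by name and retires nothing else.
-/

set_option autoImplicit false
-- the mandated namespace repeats the single-problem summit's segment (`HodgeConjecture.HodgeConjecture`)
set_option linter.dupNamespace false

noncomputable section

open scoped Matrix NNReal
open NumberField IsDedekindDomain MeasureTheory

namespace Summit.HodgeConjecture.HodgeConjecture.Cruxes.HLiu418.K2LiuDoublingSectionIntegrable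

open Literature.NumberTheory.Automorphic Literature.NumberTheory.Automorphic.UnitaryGroup
open Literature.NumberTheory.GelbartRogawski1991 Literature.NumberTheory.GelbartRogawski1991.GRConstruction
open Literature.NumberTheory.K2Lit.SiegelDoubled
open Literature.NumberTheory.GaloisRepresentations (HeckeCharacter)
open Summit.HodgeConjecture.HodgeConjecture.Cruxes.HLiu418.K2LiuDoublingHeightDecayOfNormIntegrable
open Summit.HodgeConjecture.HodgeConjecture.Cruxes.HLiu418.K2LiuAdelicNormIntegrable

/-- **PAYMENT OF `sig_K2LiuDoublingSectionIntegrable`** (socket #14a of unit U5 «DOUBLING ZETA», ED. 3–6 :59, TOKEN FOR TOKEN).  **A CONTINUOUS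
SIEGEL SECTION IS `L¹` ALONG THE DOUBLING EMBEDDING IN A RIGHT HALF-PLANE**: for non-degenerate hermitian data over a CM field (`W` a line) and
every Hecke character `χ` there is `σ₀` such that for `Re s > σ₀` every continuous `f ∈ I_Δ(s, χ)` has `g ↦ f(ι(g,1))` `ν`-integrable on `U(V)(𝔸)`
for every Haar measure `ν` (★ (I) + ★ height of record + ★ #16 + ★ p854858∕p854882, via ★ `doublingSectionIntegrable_of_adelicNormIntegrable`).
[cite: Liu2021, Lem. B.10 (2) p. 102] [cite: GelbartPiatetskishapiroRallis1987, Part A §1] -/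
theorem doublingSectionIntegrable :
    ∀ (L : Type) [Field L] [NumberField L] [IsCMField L] {N n : ℕ} (e : Fin N × Fin 1 ≃ Fin n)
      (dV : Fin N → L) (hdV : ∀ i, IsCMField.complexConj L (dV i) = dV i) (_hdV0 : ∀ i, dV i ≠ 0)
      (dW : Fin 1 → L) (hdW : ∀ i, IsCMField.complexConj L (dW i) = dW i) (_hdW0 : ∀ i, dW i ≠ 0)
      (χ : HeckeCharacter L),
      ∃ σ₀ : ℝ, ∀ (s : ℂ), σ₀ < s.re →
        ∀ (f : HA L e dV hdV dW hdW → ℂ), IsSiegelDeltaSection L e dV hdV dW hdW χ s f → Continuous f →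
          ∀ [MeasurableSpace (UnitaryGroup.adelic (Fp L) L (IsCMField.complexConj L) N (Matrix.diagonal dV))]
            [BorelSpace (UnitaryGroup.adelic (Fp L) L (IsCMField.complexConj L) N (Matrix.diagonal dV))]
            (ν : Measure (UnitaryGroup.adelic (Fp L) L (IsCMField.complexConj L) N (Matrix.diagonal dV)))
            [ν.IsHaarMeasure],
            Integrable (fun g => f (iotaLeft L e dV hdV dW hdW g)) ν :=
  doublingSectionIntegrable_of_adelicNormIntegrable adelicNormIntegrable

end Summit.HodgeConjecture.HodgeConjecture.Cruxes.HLiu418.K2LiuDoublingSectionIntegrable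

end
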